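import Summits.HodgeConjecture.CorCM.Census.CyclicCharacterEvenLocalLinearisation

/-!
# Cyclic characters, XXXVI: EVEN KERNEL, `d = 0` — THE LOWER RULE: one face per two-way tie block, toward the lower of its two nearest arc types

COR-CM (cell `pub-hodgecm2`), count-neutral kernel combinatorics by the binder seat b09 (gen 44; lane CYCLIC-CHARACTER FIBRE LAW, part XXXVI), on parts
XXXIV/XXXV and gen 38/39ʼs covering currency (`Census/BaseBlockCoveringOn.lean`: `toward_of_explicit`) BY NAME.  Theorems only (no definition, no `decide`
beyond numerals of `ℤ/4`, no certificate, no named fact, no `sorry`).  HONEST FRAMING: `HC_CM` is NOT proved, here or anywhere in the tree; nothing here is a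
period or a headline.

A TWO-WAY TIE (`k = 2`, `n = 2m`) is a type `Φ` of potential `2 ≤ bpot Φ < n` realised by two CONSECUTIVE arc types `T_0·Q⁻¹ = T_a` and `T_0·Q'⁻¹ = T_{a+1}`
(`w Q' + 1 = w Q`); in coordinates: exactly one of `x_0(Φ)`, `x_1(Φ)` equals `m` (the balanced types `x_0 = x_1 = m` have potential `n` and are excluded).
* §1 **THE LOWER ARC TYPE OF A TIE IS UNIQUE** (`rt_arcType_eq_of_tie_of_tie`): the four regions `x_0 = m > x_1` (`T_0/T_1`), `x_1 = m < x_0` (`T_1/T_2`),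
  `x_0 = m < x_1` (`T_2/T_3`), `x_1 = m > x_0` (`T_3/T_0`) are disjoint.  Being defined by the cyclic order of the arc types, «lower» is invariant under base
  change — this is what lets ONE face per block implement the rule.
* §2 **THE LOWER-RULED FAMILY** (`exists_lowerRuled`): for a decidable predicate `tie` on blocks equivalent to «the representative is a two-way tie» and an
  excluded block `E`, a face family `S_t ⊆ gfaceSet` with `|S_t| ≤ #{tie blocks ≠ E}` such that every lattice containing its base changes (i) has the toward
  property through every type of a tie block `≠ E` and (ii) obeys the LOWER RULE there: for every tie datum `(Q, Q')` at such a type `Φ` it contains a face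
  `gface Φ s s'` flipping two deviation places of `Φ` from the LOWER arc type `T_0·Q⁻¹`.
Part XXXVʼs canonical lower-left linearisation consumes (ii) (at `Q = 1`); the `d = 0` certificate (part XXXIX) is this family plus gen 38ʼs cover of the other
far blocks, an explicit UP face on `E`, the owned balanced face and one three-across face.

## References
* [Pohlmann1968] H. Pohlmann, Algebraic cycles on abelian varieties of complex multiplication type, Ann. of Math. 88 (1968), Thm 1.
-/

namespace Summit.HodgeConjecture.CorCM.Census.CyclicCharacter

open Finset
open Summit.HodgeConjecture.CorCM.Prior.AllgGroup.RfwfAllgGroup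
open Summit.HodgeConjecture.CorCM.Census.BlockParity
open Summit.HodgeConjecture.CorCM.Census.Coinvariant
open Summit.HodgeConjecture.CorCM.Census.TwistGeneration
open Summit.HodgeConjecture.CorCM.Census.BaseBlock

noncomputable section

variable {G : Type*} [Group G] [Fintype G] [DecidableEq G] {k : ℕ} {w : G → ZMod (2 ^ k)} {c : G}

/-! ## §1 The lower arc type of a two-way tie is unique -/

omit [Group G] [Fintype G] [DecidableEq G] in
/-- The successor of an arc type along a tie datum: `w Q' + 1 = w Q ⟹ −w Q' = −w Q + 1`. [folklore] -/
theorem neg_apply_eq_of_tieDatum {Q Q' : G} (h : w Q' + 1 = w Q) : -w Q' = -w Q + 1 := by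
  rw [← h]; ring

/-- **The region of a tie datum**: if `T_0·Q⁻¹` and its successor both realise the potential `< n` of `Φ`, then `−w Q` is determined by the coordinates:
`−wQ = 0 ↔ (2x_0 = n ∧ 2x_1 < n)`, `1 ↔ (2x_1 = n ∧ n < 2x_0)`, `2 ↔ (2x_0 = n ∧ n < 2x_1)`, `3 ↔ (2x_1 = n ∧ 2x_0 < n)`. [folklore] -/
theorem region_of_tieDatum (hw : ∀ P Q : G, w (P * Q) = w P + w Q) (hk : 1 ≤ k) (hk2 : k = 2) (hc2 : c * c = 1) (hwc : w c ≠ 0)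
    (h1 : ∃ g₁ : G, w g₁ = 1) {Φ : CMF G c} {Q Q' : G} (hQQ' : w Q' + 1 = w Q)
    (hlt : bpot c (arcType hw hk hc2 hwc 0) Φ < (univ.filter fun s : G => w s = 0).card)
    (hQ : bpot c (arcType hw hk hc2 hwc 0) Φ = ddist (rt c Q (arcType hw hk hc2 hwc 0)) Φ)
    (hQ' : bpot c (arcType hw hk hc2 hwc 0) Φ = ddist (rt c Q' (arcType hw hk hc2 hwc 0)) Φ) :
    (-w Q = 0 ∧ 2 * ((univ.filter fun s : G => w s = 0) \ Φ.1).card = (univ.filter fun s : G => w s = 0).card ∧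
        2 * ((univ.filter fun s : G => w s = 1) \ Φ.1).card < (univ.filter fun s : G => w s = 0).card) ∨
    (-w Q = 1 ∧ 2 * ((univ.filter fun s : G => w s = 1) \ Φ.1).card = (univ.filter fun s : G => w s = 0).card ∧
        (univ.filter fun s : G => w s = 0).card < 2 * ((univ.filter fun s : G => w s = 0) \ Φ.1).card) ∨
    (-w Q = 2 ∧ 2 * ((univ.filter fun s : G => w s = 0) \ Φ.1).card = (univ.filter fun s : G => w s = 0).card ∧
        (univ.filter fun s : G => w s = 0).card < 2 * ((univ.filter fun s : G => w s = 1) \ Φ.1).card) ∨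
    (-w Q = 3 ∧ 2 * ((univ.filter fun s : G => w s = 1) \ Φ.1).card = (univ.filter fun s : G => w s = 0).card ∧
        2 * ((univ.filter fun s : G => w s = 0) \ Φ.1).card < (univ.filter fun s : G => w s = 0).card) := by
  obtain ⟨e0, e1, e2, e3⟩ := ddist_arcType_four hw hk hk2 hc2 hwc h1 Φ
  have hmin := bpot_eq_min_four hw hk hk2 hc2 hwc h1 Φ
  have hs := neg_apply_eq_of_tieDatum hQQ'
  rw [rt_arcType_zero_eq] at hQ hQ'
  rw [hs] at hQ'
  have n01 : (0 : ZMod (2 ^ k)) + 1 = 1 := zero_add 1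
  have n11 : (1 : ZMod (2 ^ k)) + 1 = 2 := by subst hk2; decide
  have n21 : (2 : ZMod (2 ^ k)) + 1 = 3 := by subst hk2; decide
  have n31 : (3 : ZMod (2 ^ k)) + 1 = 0 := by subst hk2; decide
  rcases eq_zero_or_one_or_two_or_three hk2 (-w Q) with h | h | h | h <;> rw [h] at hQ hQ' ⊢
  · rw [n01] at hQ'; exact Or.inl ⟨rfl, by omega, by omega⟩
  · rw [n11] at hQ'; exact Or.inr (Or.inl ⟨rfl, by omega, by omega⟩)
  · rw [n21] at hQ'; exact Or.inr (Or.inr (Or.inl ⟨rfl, by omega, by omega⟩))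
  · rw [n31] at hQ'; exact Or.inr (Or.inr (Or.inr ⟨rfl, by omega, by omega⟩))

/-- **THE LOWER ARC TYPE OF A TWO-WAY TIE IS UNIQUE**: two tie data at the same type of potential `< n` have the same lower arc type. [folklore] -/
theorem rt_arcType_eq_of_tie_of_tie (hw : ∀ P Q : G, w (P * Q) = w P + w Q) (hk : 1 ≤ k) (hk2 : k = 2) (hc2 : c * c = 1) (hwc : w c ≠ 0)
    (h1 : ∃ g₁ : G, w g₁ = 1) {Φ : CMF G c} {Q Q' P P' : G} (hQQ' : w Q' + 1 = w Q) (hPP' : w P' + 1 = w P)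
    (hlt : bpot c (arcType hw hk hc2 hwc 0) Φ < (univ.filter fun s : G => w s = 0).card)
    (hQ : bpot c (arcType hw hk hc2 hwc 0) Φ = ddist (rt c Q (arcType hw hk hc2 hwc 0)) Φ)
    (hQ' : bpot c (arcType hw hk hc2 hwc 0) Φ = ddist (rt c Q' (arcType hw hk hc2 hwc 0)) Φ)
    (hP : bpot c (arcType hw hk hc2 hwc 0) Φ = ddist (rt c P (arcType hw hk hc2 hwc 0)) Φ)
    (hP' : bpot c (arcType hw hk hc2 hwc 0) Φ = ddist (rt c P' (arcType hw hk hc2 hwc 0)) Φ) :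
    rt c Q (arcType hw hk hc2 hwc 0) = rt c P (arcType hw hk hc2 hwc 0) := by
  have hrQ := region_of_tieDatum hw hk hk2 hc2 hwc h1 hQQ' hlt hQ hQ'
  have hrP := region_of_tieDatum hw hk hk2 hc2 hwc h1 hPP' hlt hP hP'
  rw [rt_arcType_zero_eq, rt_arcType_zero_eq]
  have key : -w Q = -w P := by
    rcases hrQ with ⟨hq, a1, a2⟩ | ⟨hq, a1, a2⟩ | ⟨hq, a1, a2⟩ | ⟨hq, a1, a2⟩ <;>
      rcases hrP with ⟨hp, b1, b2⟩ | ⟨hp, b1, b2⟩ | ⟨hp, b1, b2⟩ | ⟨hp, b1, b2⟩ <;>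
      (rw [hq, hp]; try (exfalso; omega))
  rw [key]

/-- **Tie data transport along base changes**: a tie datum `(Q, Q')` at `Ψ` gives the tie datum `(P·Q, P·Q')` at `Ψ·P⁻¹`. [folklore] -/
theorem tieDatum_rt (hw : ∀ P Q : G, w (P * Q) = w P + w Q) (hk : 1 ≤ k) (hc2 : c * c = 1) (hwc : w c ≠ 0) {Ψ : CMF G c} {Q Q' : G} (P : G)
    (hQQ' : w Q' + 1 = w Q) (hQ : bpot c (arcType hw hk hc2 hwc 0) Ψ = ddist (rt c Q (arcType hw hk hc2 hwc 0)) Ψ)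
    (hQ' : bpot c (arcType hw hk hc2 hwc 0) Ψ = ddist (rt c Q' (arcType hw hk hc2 hwc 0)) Ψ) :
    w (P * Q') + 1 = w (P * Q) ∧ bpot c (arcType hw hk hc2 hwc 0) (rt c P Ψ) = ddist (rt c (P * Q) (arcType hw hk hc2 hwc 0)) (rt c P Ψ) ∧
      bpot c (arcType hw hk hc2 hwc 0) (rt c P Ψ) = ddist (rt c (P * Q') (arcType hw hk hc2 hwc 0)) (rt c P Ψ) := by
  refine ⟨by rw [hw, hw, ← hQQ', add_assoc], ?_, ?_⟩
  · rw [bpot_rt, rt_mul, ddist_rt]; exact hQ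
  · rw [bpot_rt, rt_mul, ddist_rt]; exact hQ'

/-! ## §2 The lower-ruled family -/

/-- **THE LOWER-RULED FAMILY** (see the file header). [folklore] -/
theorem exists_lowerRuled (hw : ∀ P Q : G, w (P * Q) = w P + w Q) (hk : 1 ≤ k) (hk2 : k = 2) (hc2 : c * c = 1) (hwc : w c ≠ 0)
    (h1 : ∃ g₁ : G, w g₁ = 1) (tie : Block c → Prop) [DecidablePred tie]
    (htie : ∀ Bk : Block c, tie Bk ↔ (2 ≤ bpot c (arcType hw hk hc2 hwc 0) Bk.out ∧
      bpot c (arcType hw hk hc2 hwc 0) Bk.out < (univ.filter fun s : G => w s = 0).card ∧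
      ∃ Q Q' : G, w Q' + 1 = w Q ∧ bpot c (arcType hw hk hc2 hwc 0) Bk.out = ddist (rt c Q (arcType hw hk hc2 hwc 0)) Bk.out ∧
        bpot c (arcType hw hk hc2 hwc 0) Bk.out = ddist (rt c Q' (arcType hw hk hc2 hwc 0)) Bk.out)) (E : Block c) :
    ∃ St : Finset (CMF G c →₀ ℤ), (↑St ⊆ gfaceSet G c hc2) ∧ St.card ≤ (univ.filter fun Bk : Block c => tie Bk ∧ Bk ≠ E).card ∧
      ∀ L : Submodule ℤ (CMF G c →₀ ℤ), Submodule.span ℤ (translates c St) ≤ L →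
        (∀ Φ : CMF G c, tie (blk c Φ) → blk c Φ ≠ E → ∃ Q t t' : G,
          bpot c (arcType hw hk hc2 hwc 0) Φ = ddist (rt c Q (arcType hw hk hc2 hwc 0)) Φ ∧
            t ∈ (rt c Q (arcType hw hk hc2 hwc 0)).1 \ Φ.1 ∧ t' ∈ (rt c Q (arcType hw hk hc2 hwc 0)).1 \ Φ.1 ∧ t ≠ t' ∧ gface c hc2 Φ t t' ∈ L) ∧
        (∀ (Φ : CMF G c) (Q Q' : G), blk c Φ ≠ E → w Q' + 1 = w Q → 2 ≤ bpot c (arcType hw hk hc2 hwc 0) Φ →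
          bpot c (arcType hw hk hc2 hwc 0) Φ < (univ.filter fun s : G => w s = 0).card →
          bpot c (arcType hw hk hc2 hwc 0) Φ = ddist (rt c Q (arcType hw hk hc2 hwc 0)) Φ →
          bpot c (arcType hw hk hc2 hwc 0) Φ = ddist (rt c Q' (arcType hw hk hc2 hwc 0)) Φ →
          ∃ s s' : G, s ∈ (rt c Q (arcType hw hk hc2 hwc 0)).1 \ Φ.1 ∧ s' ∈ (rt c Q (arcType hw hk hc2 hwc 0)).1 \ Φ.1 ∧ s ≠ s' ∧
            gface c hc2 Φ s s' ∈ L) := by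
  classical
  set T₀ := arcType hw hk hc2 hwc 0 with hT₀
  -- the choice at every tie block: a tie datum and two deviation places from its lower arc type
  have hch : ∀ Bk : Block c, ∃ τ : (G × G) × (G × G), tie Bk →
      w τ.1.2 + 1 = w τ.1.1 ∧ bpot c T₀ Bk.out = ddist (rt c τ.1.1 T₀) Bk.out ∧ bpot c T₀ Bk.out = ddist (rt c τ.1.2 T₀) Bk.out ∧
        τ.2.1 ∈ (rt c τ.1.1 T₀).1 \ Bk.out.1 ∧ τ.2.2 ∈ (rt c τ.1.1 T₀).1 \ Bk.out.1 ∧ τ.2.1 ≠ τ.2.2 := by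
    intro Bk
    by_cases h : tie Bk
    · obtain ⟨h2, -, Q, Q', hQQ', hQ, hQ'⟩ := (htie Bk).mp h
      have hcard : 1 < ((rt c Q T₀).1 \ Bk.out.1).card := by rw [hQ, ddist] at h2; omega
      obtain ⟨s, hs, s', hs', hss'⟩ := one_lt_card.mp hcard
      exact ⟨((Q, Q'), (s, s')), fun _ => ⟨hQQ', hQ, hQ', hs, hs', hss'⟩⟩
    · exact ⟨((1, 1), (1, 1)), fun h' => absurd h' h⟩
  choose τ hτ using hch
  set NI : Finset (Block c) := univ.filter fun Bk : Block c => tie Bk ∧ Bk ≠ E with hNI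
  set face : Block c → (CMF G c →₀ ℤ) := fun Bk => gface c hc2 Bk.out (τ Bk).2.1 (τ Bk).2.2 with hface
  refine ⟨NI.image face, ?_, card_image_le, fun L hL => ⟨fun Φ hΦ hΦE => ?_, fun Φ Q₁ Q₁' hΦE hQQ₁ h2 hlt hQ₁ hQ₁' => ?_⟩⟩
  · intro y hy
    obtain ⟨Bk, hBk, rfl⟩ := mem_image.mp (mem_coe.mp hy)
    obtain ⟨-, -, -, hs, hs', hss'⟩ := hτ Bk (mem_filter.mp hBk).2.1
    exact ⟨Bk.out, _, _, not_mem_orb_of_mem (mem_sdiff.mp hs).1 (mem_sdiff.mp hs').1 hss', rfl⟩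
  · -- the toward property through every type of a non-excluded tie block
    have hmem : face (blk c Φ) ∈ NI.image face := mem_image_of_mem _ (mem_filter.mpr ⟨mem_univ _, hΦ, hΦE⟩)
    obtain ⟨-, hQ, -, hs, hs', hss'⟩ := hτ (blk c Φ) hΦ
    exact toward_of_explicit c T₀ hc2 L hQ hs hs' hss' (fun Q'' => hL (Submodule.subset_span ⟨Q'', _, hmem, rfl⟩)) (blk_out c (blk c Φ)).symm
  · -- the lower rule: the blockʼs face, transported to `Φ`, is toward the lower arc type of EVERY tie datum at `Φ`
    set Bk : Block c := blk c Φ with hBk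
    obtain ⟨P, hP⟩ := exists_rt_eq_of_blk_eq c (blk_out c Bk)
    -- `Φ = Bk.out·P⁻¹`; the tie datum `(P⁻¹Q₁, P⁻¹Q₁')` at `Bk.out` shows the block is a tie block
    have hinv : rt c P⁻¹ Φ = Bk.out := by rw [← hP, rt_inv_rt]
    have hdat := tieDatum_rt hw hk hc2 hwc P⁻¹ hQQ₁ hQ₁ hQ₁'
    rw [hinv] at hdat
    obtain ⟨hd1, hd2, hd3⟩ := hdat
    have hpot : bpot c T₀ Φ = bpot c T₀ Bk.out := by rw [← bpot_rt c T₀ P Bk.out, hP]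
    have htieBk : tie Bk := (htie _).mpr ⟨by rw [← hpot]; exact h2, by rw [← hpot]; exact hlt, _, _, hd1, hd2, hd3⟩
    have hmem : face Bk ∈ NI.image face := mem_image_of_mem _ (mem_filter.mpr ⟨mem_univ _, htieBk, hΦE⟩)
    obtain ⟨hQQ', hQ, hQ', hs, hs', hss'⟩ := hτ Bk htieBk
    -- transport the blockʼs datum to `Φ`
    obtain ⟨he1, he2, he3⟩ := tieDatum_rt hw hk hc2 hwc P hQQ' hQ hQ'
    rw [hP] at he2 he3
    have hlow : rt c (P * (τ Bk).1.1) T₀ = rt c Q₁ T₀ := rt_arcType_eq_of_tie_of_tie hw hk hk2 hc2 hwc h1 he1 hQQ₁ hlt he2 he3 hQ₁ hQ₁'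
    have hfaceL : gface c hc2 Φ ((τ Bk).2.1 * P⁻¹) ((τ Bk).2.2 * P⁻¹) ∈ L := by
      have h := hL (Submodule.subset_span ⟨P, face Bk, hmem, rfl⟩)
      rwa [show face Bk = gface c hc2 Bk.out (τ Bk).2.1 (τ Bk).2.2 from rfl, mapDomain_rt_gface, hP] at h
    refine ⟨(τ Bk).2.1 * P⁻¹, (τ Bk).2.2 * P⁻¹, ?_, ?_, fun h => hss' (mul_right_cancel h), hfaceL⟩
    · rw [← hlow, rt_mul, ← hP, mem_sdiff_rt_iff, inv_mul_cancel_right]; exact hs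
    · rw [← hlow, rt_mul, ← hP, mem_sdiff_rt_iff, inv_mul_cancel_right]; exact hs'

end

end Summit.HodgeConjecture.CorCM.Census.CyclicCharacter
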